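import Summits.Ventures.QEC.Thresholds.CSSFamilyThresholds
import Summits.Ventures.QEC.Basic.HypergraphProductCensus
import Literature.InformationTheory.QuantumCodes.HypergraphProductWeights
import Literature.InformationTheory.QuantumCodes.HypergraphProductDistance
import Literature.InformationTheory.QuantumCodes.CSSFiniteSizeBounds
import HarnessLib

/-!
# Certified thresholds for HYPERGRAPH-PRODUCT census families with explicit seed degrees `(Δ_q, Δ_c)`:
# `p₀(Δ_q+Δ_c-1)` (code capacity), `1/(Δ_q+Δ_c-1)` (erasure), `p₀(Δ_q+Δ_c+1)` (phenomenological), both sectors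

Venture QEC, `Summits/Ventures/QEC/Thresholds/` (LADDER-QEC rung Q5, cell Q5.hgp; qec-type-09 gen 3, item 09.HGPTH).
The census cell B.1 (CENSUS-PREREG) consists of hypergraph products `Summit.Ventures.QEC.HGP.code H₁ H₂`
(`H^X = [H₁ ⊗ 1 | 1 ⊗ H₂ᵀ]`, `H^Z = [1 ⊗ H₂ | H₁ᵀ ⊗ 1]`, qubits `(Fin n₁ × Fin n₂) ⊕ (Fin m₁ × Fin m₂)`;
row type-04's `Basic/HypergraphProductCensus.lean`) of registered classical seeds, among them the 15 registered
`(3,4)`-regular Gallager matrices (every bit in `3` checks, every check on `4` bits; set `B1gal`). This file turns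
the SEED DEGREES into certified threshold statements for such families, through `CSSFamilyThresholds.lean`:

* `IsDegreeBounded H Δq Δc` — column weights `≤ Δ_q`, row weights `≤ Δ_c` (definition, decidable on census seeds);
* check weights of the product: `hgp_card_rowSupp_HX_le` (`≤ Δ_c(H₁) + Δ_q(H₂)`), `hgp_card_rowSupp_HZ_le`
  (`≤ Δ_q(H₁) + Δ_c(H₂)`) — Tillich–Zémor §4 row weights, from the tree's `hammingNorm_xMatrix_row_le` /
  `hammingNorm_zMatrix_row_le`;
* sector distances from the seeds (Tillich–Zémor Thm 9, both halves, PROVED in the tree): `hgp_le_weight_zLogical`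
  (`Z`-logicals have weight `≥ min(d(ker H₁), d(ker H₂ᵀ))`), `hgp_le_weight_xLogical` (`≥ min(d(ker H₁ᵀ), d(ker H₂))`);
* the six family theorems `hgp_z|x_isThresholdLowerBound` (code capacity `p₀(w-1)`), `hgp_z|x_erasure_…` (`1/(w-1)`),
  `hgp_z|x_phenom_…` (`p₀(w+1)`), `w` = the sector's check weight bound, for every family of seed pairs with the
  stated degree bounds whose seed distances `d i` make the size subexponential (`(n₁n₂ + m₁m₂)·r^{d i} → 0`);
* FINITE SIZE, for the census rows themselves: `hgp_zFailureProb_le_of_isCode` — a census row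
  `(HGP.code H₁ H₂).IsCode n k d` with `(Δ_q, Δ_c)`-bounded seeds has, for EVERY minimum-weight decoder and every
  `0 ≤ p ≤ 1/2` with `2(Δ_q+Δ_c-1)s < 1` (`s = √(p(1-p))`), `P_fail ≤ n·(2(Δ_q+Δ_c-1)s)^d/((Δ_q+Δ_c-1)(1-2(Δ_q+Δ_c-1)s))`
  (qec-lit-2's `CSSCode.zFailureProb_le_of_rowWeight`, `CSSFiniteSizeBounds.lean`).
The `(Δ_q, Δ_c) = (3, 4)` Gallager class (numbers `p₀(6)`, `1/6`, `p₀(8)`) and the census-row instance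
`[[100, 20, 4]]` are `GallagerHGPThresholds.lean`; the toric codes as hypergraph products (degrees `(2,2)`, growth
hypothesis PROVED) are `ToricCodeHGPThresholds.lean`.

HONEST FRAMING: every family theorem is UNCONDITIONAL for every family satisfying its hypotheses (kernel axioms, no
named fact, no `native_decide`); the growth hypothesis (seed distances `→ ∞` faster than `log` of the size) is a
hypothesis, not discharged in this file. The thresholds are per SECTOR under independent `X`/`Z` noise and
minimum-weight decoding; nothing is claimed about BP-OSD or about Monte Carlo crossings (VALIDATED column).

## References

* [TillichZemor2014] J.-P. Tillich, G. Zémor, IEEE Trans. IT 60 (2014) 1193, §4 (row weights), Thm 9.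
* [DumerKovalevPryadko2015] I. Dumer, A. A. Kovalev, L. P. Pryadko, PRL 115 (2015) 050502, Thms 2–3, p. 5.
* [Gallager1963] R. G. Gallager, Low-Density Parity-Check Codes, MIT Press 1963, §2.1 ((j,k)-regular matrices: the degree vocabulary).
* [DennisEtAl2002] E. Dennis, A. Kitaev, A. Landahl, J. Preskill, J. Math. Phys. 43 (2002) 4452, §5.3.
-/

noncomputable section

namespace Summit.Ventures.QEC.Thresholds

open Filter Topology Finset Matrix
open Literature.InformationTheory.QuantumCodes
open Literature.InformationTheory.Coding (minDist)

/-! ### Degree-bounded seeds and the check weights / sector distances of the product -/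

/-- A binary parity-check matrix is **`(Δ_q, Δ_c)`-bounded** (LDPC degrees): every column has weight `≤ Δ_q`
(each bit lies in at most `Δ_q` checks) and every row has weight `≤ Δ_c` (each check involves at most `Δ_c` bits).
Gallager's `(j,k)`-regular matrices are `(j,k)`-bounded. [cite: Gallager1963, §2.1 (matrices with j ones per column and k ones per row)] -/
def IsDegreeBounded {m n : ℕ} (H : Matrix (Fin m) (Fin n) (ZMod 2)) (Δq Δc : ℕ) : Prop :=
  (∀ j : Fin n, hammingNorm (fun a => H a j) ≤ Δq) ∧ ∀ a : Fin m, hammingNorm (H a) ≤ Δc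

section OnePair

variable {m₁ n₁ m₂ n₂ : ℕ}

/-- **`X`-check weights of `HGP(H₁,H₂)`**: if the rows of `H₁` have weight `≤ c₁` and the COLUMNS of `H₂` weight
`≤ q₂`, every row of `H^X = [H₁ ⊗ 1 | 1 ⊗ H₂ᵀ]` has weight `≤ c₁ + q₂`. [cite: TillichZemor2014, §4 (row weights of the product hypergraph; arXiv v1 chunk p0007 L25-45)] -/
theorem hgp_card_rowSupp_HX_le (H₁ : Matrix (Fin m₁) (Fin n₁) (ZMod 2)) (H₂ : Matrix (Fin m₂) (Fin n₂) (ZMod 2))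
    {c₁ q₂ : ℕ} (h₁ : ∀ a, hammingNorm (H₁ a) ≤ c₁) (h₂ : ∀ j, hammingNorm (fun b => H₂ b j) ≤ q₂)
    (x : Fin m₁ × Fin n₂) : (rowSupp (HGP.code H₁ H₂).HX x).card ≤ c₁ + q₂ :=
  HypergraphProduct.card_rowSupp_xMatrix_le H₁ H₂ᵀ h₁ (fun j => h₂ j) x

/-- **`Z`-check weights of `HGP(H₁,H₂)`**: if the COLUMNS of `H₁` have weight `≤ q₁` and the rows of `H₂` weight
`≤ c₂`, every row of `H^Z = [1 ⊗ H₂ | H₁ᵀ ⊗ 1]` has weight `≤ q₁ + c₂`. [cite: TillichZemor2014, §3-§4 (|C_{αβ}| = |α| + |β|; arXiv v1 chunk p0006 L82-90)] -/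
theorem hgp_card_rowSupp_HZ_le (H₁ : Matrix (Fin m₁) (Fin n₁) (ZMod 2)) (H₂ : Matrix (Fin m₂) (Fin n₂) (ZMod 2))
    {q₁ c₂ : ℕ} (h₁ : ∀ i, hammingNorm (fun a => H₁ a i) ≤ q₁) (h₂ : ∀ b, hammingNorm (H₂ b) ≤ c₂)
    (x : Fin n₁ × Fin m₂) : (rowSupp (HGP.code H₁ H₂).HZ x).card ≤ q₁ + c₂ := by
  rw [card_rowSupp_eq_hammingNorm]
  obtain ⟨α, β⟩ := x
  exact (HypergraphProduct.hammingNorm_zMatrix_row_le H₁ H₂ᵀ α β).trans (Nat.add_le_add (h₁ α) (h₂ β))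

/-- **`Z`-logicals of `HGP(H₁,H₂)` have weight `≥ min(d(ker H₁), d(ker H₂ᵀ))`** (Tillich–Zémor Thm 9, cycle half,
for the product `ℋ₁·ℋ₂ᵀ`): if `d ≤ d(ker H₁)` and `d ≤ d(ker H₂ᵀ)` in `ℕ∞`, every `x` with `H^X x = 0`,
`x ∉ rs H^Z` has `|x| ≥ d`. [cite: TillichZemor2014, Thm 9 (arXiv v1 chunk p0008 L11-45)] -/
theorem hgp_le_weight_zLogical (H₁ : Matrix (Fin m₁) (Fin n₁) (ZMod 2)) (H₂ : Matrix (Fin m₂) (Fin n₂) (ZMod 2))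
    {d : ℕ} (hd₁ : (d : ℕ∞) ≤ minDist (pcCode H₁)) (hd₂ : (d : ℕ∞) ≤ minDist (pcCode H₂ᵀ))
    (x : (Fin n₁ × Fin n₂) ⊕ (Fin m₁ × Fin m₂) → ZMod 2) (hx : (HGP.code H₁ H₂).HX *ᵥ x = 0)
    (hxS : x ∉ (HGP.code H₁ H₂).rowSpZ) : d ≤ hammingNorm x :=
  HypergraphProduct.le_hammingNorm_of_cycle H₁ H₂ᵀ hd₁ hd₂ x hx hxS

/-- **`X`-logicals of `HGP(H₁,H₂)` have weight `≥ min(d(ker H₁ᵀ), d(ker H₂))`** (Tillich–Zémor Thm 9, cocycle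
half, `(H₂ᵀ)ᵀ = H₂`). [cite: TillichZemor2014, Thm 9 (arXiv v1 chunk p0008 L46-50)] -/
theorem hgp_le_weight_xLogical (H₁ : Matrix (Fin m₁) (Fin n₁) (ZMod 2)) (H₂ : Matrix (Fin m₂) (Fin n₂) (ZMod 2))
    {d : ℕ} (hd₁ : (d : ℕ∞) ≤ minDist (pcCode H₁ᵀ)) (hd₂ : (d : ℕ∞) ≤ minDist (pcCode H₂))
    (x : (Fin n₁ × Fin n₂) ⊕ (Fin m₁ × Fin m₂) → ZMod 2) (hx : (HGP.code H₁ H₂).HZ *ᵥ x = 0)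
    (hxS : x ∉ (HGP.code H₁ H₂).rowSpX) : d ≤ hammingNorm x := by
  have h := HypergraphProduct.min_le_hammingNorm_of_cocycle H₁ H₂ᵀ (e := x) hx hxS
  rw [Matrix.transpose_transpose] at h
  have h' : (d : ℕ∞) ≤ (hammingNorm x : ℕ∞) := (le_min hd₁ hd₂).trans h
  exact_mod_cast h'

open Classical in
/-- **Finite-size certified bound for a census row** (`Z`-sector): if both seeds are `(Δ_q, Δ_c)`-bounded
(`Δ_q + Δ_c ≥ 2`) and the row is certified `[[n, k, d]]` (`CSSCode.IsCode`, exact distance, so `d ≤ d^Z` and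
`k > 0`), then for EVERY minimum-weight decoder of the `X`-syndrome and every `0 ≤ p ≤ 1/2` with
`2(Δ_q+Δ_c-1)√(p(1-p)) < 1`: `P_fail ≤ n·(2(Δ_q+Δ_c-1)s)^d / ((Δ_q+Δ_c-1)(1 - 2(Δ_q+Δ_c-1)s))`, `s = √(p(1-p))`.
[cite: DumerKovalevPryadko2015, Thm 2 (y = 0) with eq. (upper-bound-Nm-CSS)] -/
theorem hgp_zFailureProb_le_of_isCode (H₁ : Matrix (Fin m₁) (Fin n₁) (ZMod 2))
    (H₂ : Matrix (Fin m₂) (Fin n₂) (ZMod 2)) {Δq Δc : ℕ} (hΔ : 2 ≤ Δq + Δc)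
    (hB₁ : IsDegreeBounded H₁ Δq Δc) (hB₂ : IsDegreeBounded H₂ Δq Δc) {n k d : ℕ}
    (hC : (HGP.code H₁ H₂).IsCode n k d)
    {D : Decoder ((Fin m₁ × Fin n₂) → ZMod 2) (((Fin n₁ × Fin n₂) ⊕ (Fin m₁ × Fin m₂)) → ZMod 2)}
    (hD : D.IsMinWeight (HGP.code H₁ H₂).zSyndrome
      ((HGP.code H₁ H₂).kerX : Set (((Fin n₁ × Fin n₂) ⊕ (Fin m₁ × Fin m₂)) → ZMod 2)) hammingNorm)
    {p : ℝ} (hp0 : 0 ≤ p) (hp : p ≤ 1 / 2)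
    (hr : 2 * ((Δq + Δc - 1 : ℕ) : ℝ) * Real.sqrt (p * (1 - p)) < 1) :
    ∑ e ∈ univ.filter (fun e : ((Fin n₁ × Fin n₂) ⊕ (Fin m₁ × Fin m₂)) → ZMod 2 =>
        ¬ D.Corrects (HGP.code H₁ H₂).zSyndrome
          ((HGP.code H₁ H₂).rowSpZ : Set (((Fin n₁ × Fin n₂) ⊕ (Fin m₁ × Fin m₂)) → ZMod 2)) e),
        bernoulliWeight p (supp e) ≤
      (n : ℝ) * (2 * ((Δq + Δc - 1 : ℕ) : ℝ) * Real.sqrt (p * (1 - p))) ^ d /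
        (((Δq + Δc - 1 : ℕ) : ℝ) * (1 - 2 * ((Δq + Δc - 1 : ℕ) : ℝ) * Real.sqrt (p * (1 - p)))) := by
  have hrow : ∀ x, (rowSupp (HGP.code H₁ H₂).HX x).card ≤ Δq + Δc := fun x =>
    (hgp_card_rowSupp_HX_le H₁ H₂ hB₁.2 hB₂.1 x).trans (by omega)
  have hdZ : d ≤ (HGP.code H₁ H₂).dZ := hC.le_dX_and_le_dZ.2.1
  have hk : 0 < (HGP.code H₁ H₂).k := by rw [hC.2.1]; exact hC.k_pos
  have hd1 : 1 ≤ (HGP.code H₁ H₂).dZ := (HGP.code H₁ H₂).dZ_pos_of_k_pos hk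
  have h := (HGP.code H₁ H₂).zFailureProb_le_of_rowWeight hD hΔ hrow hd1 hp0 hp hr
  refine h.trans ?_
  have hn : (Fintype.card ((Fin n₁ × Fin n₂) ⊕ (Fin m₁ × Fin m₂)) : ℝ) = n := by exact_mod_cast hC.1
  set K : ℝ := ((Δq + Δc - 1 : ℕ) : ℝ) with hK
  set r : ℝ := 2 * K * Real.sqrt (p * (1 - p)) with hrdef
  have hK1 : 1 ≤ K := by rw [hK]; exact_mod_cast (show 1 ≤ Δq + Δc - 1 by omega)
  have hr0 : 0 ≤ r := by rw [hrdef]; have := Real.sqrt_nonneg (p * (1 - p)); positivity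
  have hden : 0 ≤ K * (1 - r) := mul_nonneg (by linarith) (by linarith)
  rw [hn]
  exact div_le_div_of_nonneg_right
    (mul_le_mul_of_nonneg_left (pow_le_pow_of_le_one hr0 hr.le hdZ) (Nat.cast_nonneg n)) hden

end OnePair

/-! ### Families of hypergraph products with degree-bounded seeds -/

section Family

variable {m₁ n₁ m₂ n₂ : ℕ → ℕ}

/-- **`Z`-sector code-capacity threshold of an HGP family `≥ p₀(c₁ + q₂ - 1)`**: rows of `H₁ i` of weight `≤ c₁`,
columns of `H₂ i` of weight `≤ q₂` (so `X`-checks of weight `≤ w = c₁ + q₂ ≥ 2`), seed distances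
`d i ≤ d(ker H₁ i)`, `d i ≤ d(ker (H₂ i)ᵀ)` with `d i ≥ 1` and `(n₁n₂ + m₁m₂)·r^{d i} → 0` for all `0 < r < 1`, ANY
minimum-weight decoders: every `0 ≤ p < p₀(w-1)` is below threshold. UNCONDITIONAL.
[cite: DumerKovalevPryadko2015, Thm 2 (y = 0)] [cite: TillichZemor2014, §4 and Thm 9] -/
theorem hgp_z_isThresholdLowerBound (H₁ : ∀ i, Matrix (Fin (m₁ i)) (Fin (n₁ i)) (ZMod 2))
    (H₂ : ∀ i, Matrix (Fin (m₂ i)) (Fin (n₂ i)) (ZMod 2))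
    (D : ∀ i, Decoder ((Fin (m₁ i) × Fin (n₂ i)) → ZMod 2)
      (((Fin (n₁ i) × Fin (n₂ i)) ⊕ (Fin (m₁ i) × Fin (m₂ i))) → ZMod 2))
    (hD : ∀ i, (D i).IsMinWeight (HGP.code (H₁ i) (H₂ i)).zSyndrome
      ((HGP.code (H₁ i) (H₂ i)).kerX : Set _) hammingNorm)
    {c₁ q₂ : ℕ} (hw : 2 ≤ c₁ + q₂) (h₁ : ∀ i a, hammingNorm (H₁ i a) ≤ c₁)
    (h₂ : ∀ i j, hammingNorm (fun b => H₂ i b j) ≤ q₂) (d : ℕ → ℕ) (hd1 : ∀ i, 1 ≤ d i)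
    (hd₁ : ∀ i, (d i : ℕ∞) ≤ minDist (pcCode (H₁ i))) (hd₂ : ∀ i, (d i : ℕ∞) ≤ minDist (pcCode (H₂ i)ᵀ))
    (hgrowth : ∀ r : ℝ, 0 < r → r < 1 →
      Tendsto (fun i => ((n₁ i * n₂ i + m₁ i * m₂ i : ℕ) : ℝ) * r ^ d i) atTop (𝓝 0)) :
    IsThresholdLowerBound (zFailureFamily (fun i => HGP.code (H₁ i) (H₂ i)) D)
      (thresholdValue ((c₁ + q₂ - 1 : ℕ) : ℝ)) := by
  refine z_isThresholdLowerBound_of_rowWeight _ D hD hw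
    (fun i x => hgp_card_rowSupp_HX_le _ _ (h₁ i) (h₂ i) x) d hd1
    (fun i x hx hxS => hgp_le_weight_zLogical _ _ (hd₁ i) (hd₂ i) x hx hxS) fun r hr0 hr1 => ?_
  exact (hgrowth r hr0 hr1).congr fun i => by rw [HGP.card_qubits]

/-- **`X`-sector code-capacity threshold of an HGP family `≥ p₀(q₁ + c₂ - 1)`**: columns of `H₁ i` of weight
`≤ q₁`, rows of `H₂ i` of weight `≤ c₂` (`Z`-checks of weight `≤ q₁ + c₂ ≥ 2`), `d i ≤ d(ker (H₁ i)ᵀ)`,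
`d i ≤ d(ker H₂ i)`, growth as above, ANY minimum-weight decoders of the `Z`-syndrome. UNCONDITIONAL.
[cite: DumerKovalevPryadko2015, Thm 2 (y = 0)] [cite: TillichZemor2014, §4 and Thm 9] -/
theorem hgp_x_isThresholdLowerBound (H₁ : ∀ i, Matrix (Fin (m₁ i)) (Fin (n₁ i)) (ZMod 2))
    (H₂ : ∀ i, Matrix (Fin (m₂ i)) (Fin (n₂ i)) (ZMod 2))
    (D : ∀ i, Decoder ((Fin (n₁ i) × Fin (m₂ i)) → ZMod 2)
      (((Fin (n₁ i) × Fin (n₂ i)) ⊕ (Fin (m₁ i) × Fin (m₂ i))) → ZMod 2))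
    (hD : ∀ i, (D i).IsMinWeight (HGP.code (H₁ i) (H₂ i)).xSyndrome
      ((HGP.code (H₁ i) (H₂ i)).kerZ : Set _) hammingNorm)
    {q₁ c₂ : ℕ} (hw : 2 ≤ q₁ + c₂) (h₁ : ∀ i j, hammingNorm (fun a => H₁ i a j) ≤ q₁)
    (h₂ : ∀ i b, hammingNorm (H₂ i b) ≤ c₂) (d : ℕ → ℕ) (hd1 : ∀ i, 1 ≤ d i)
    (hd₁ : ∀ i, (d i : ℕ∞) ≤ minDist (pcCode (H₁ i)ᵀ)) (hd₂ : ∀ i, (d i : ℕ∞) ≤ minDist (pcCode (H₂ i)))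
    (hgrowth : ∀ r : ℝ, 0 < r → r < 1 →
      Tendsto (fun i => ((n₁ i * n₂ i + m₁ i * m₂ i : ℕ) : ℝ) * r ^ d i) atTop (𝓝 0)) :
    IsThresholdLowerBound (xFailureFamily (fun i => HGP.code (H₁ i) (H₂ i)) D)
      (thresholdValue ((q₁ + c₂ - 1 : ℕ) : ℝ)) := by
  refine x_isThresholdLowerBound_of_rowWeight _ D hD hw
    (fun i x => hgp_card_rowSupp_HZ_le _ _ (h₁ i) (h₂ i) x) d hd1
    (fun i x hx hxS => hgp_le_weight_xLogical _ _ (hd₁ i) (hd₂ i) x hx hxS) fun r hr0 hr1 => ?_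
  exact (hgrowth r hr0 hr1).congr fun i => by rw [HGP.card_qubits]

/-- **`Z`-sector erasure threshold of an HGP family `≥ 1/(c₁ + q₂ - 1)`** (hypotheses as in
`hgp_z_isThresholdLowerBound`). UNCONDITIONAL. [cite: DumerKovalevPryadko2015, Thm 2 (erasure part)] -/
theorem hgp_z_erasure_isThresholdLowerBound (H₁ : ∀ i, Matrix (Fin (m₁ i)) (Fin (n₁ i)) (ZMod 2))
    (H₂ : ∀ i, Matrix (Fin (m₂ i)) (Fin (n₂ i)) (ZMod 2))
    {c₁ q₂ : ℕ} (hw : 2 ≤ c₁ + q₂) (h₁ : ∀ i a, hammingNorm (H₁ i a) ≤ c₁)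
    (h₂ : ∀ i j, hammingNorm (fun b => H₂ i b j) ≤ q₂) (d : ℕ → ℕ) (hd1 : ∀ i, 1 ≤ d i)
    (hd₁ : ∀ i, (d i : ℕ∞) ≤ minDist (pcCode (H₁ i))) (hd₂ : ∀ i, (d i : ℕ∞) ≤ minDist (pcCode (H₂ i)ᵀ))
    (hgrowth : ∀ r : ℝ, 0 < r → r < 1 →
      Tendsto (fun i => ((n₁ i * n₂ i + m₁ i * m₂ i : ℕ) : ℝ) * r ^ d i) atTop (𝓝 0)) :
    IsThresholdLowerBound (zErasureFamily (fun i => HGP.code (H₁ i) (H₂ i))) (1 / ((c₁ + q₂ - 1 : ℕ) : ℝ)) := by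
  refine z_erasure_isThresholdLowerBound_of_rowWeight _ hw
    (fun i x => hgp_card_rowSupp_HX_le _ _ (h₁ i) (h₂ i) x) d hd1
    (fun i x hx hxS => hgp_le_weight_zLogical _ _ (hd₁ i) (hd₂ i) x hx hxS) fun r hr0 hr1 => ?_
  exact (hgrowth r hr0 hr1).congr fun i => by rw [HGP.card_qubits]

/-- **`X`-sector erasure threshold of an HGP family `≥ 1/(q₁ + c₂ - 1)`** (hypotheses as in
`hgp_x_isThresholdLowerBound`). UNCONDITIONAL. [cite: DumerKovalevPryadko2015, Thm 2 (erasure part)] -/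
theorem hgp_x_erasure_isThresholdLowerBound (H₁ : ∀ i, Matrix (Fin (m₁ i)) (Fin (n₁ i)) (ZMod 2))
    (H₂ : ∀ i, Matrix (Fin (m₂ i)) (Fin (n₂ i)) (ZMod 2))
    {q₁ c₂ : ℕ} (hw : 2 ≤ q₁ + c₂) (h₁ : ∀ i j, hammingNorm (fun a => H₁ i a j) ≤ q₁)
    (h₂ : ∀ i b, hammingNorm (H₂ i b) ≤ c₂) (d : ℕ → ℕ) (hd1 : ∀ i, 1 ≤ d i)
    (hd₁ : ∀ i, (d i : ℕ∞) ≤ minDist (pcCode (H₁ i)ᵀ)) (hd₂ : ∀ i, (d i : ℕ∞) ≤ minDist (pcCode (H₂ i)))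
    (hgrowth : ∀ r : ℝ, 0 < r → r < 1 →
      Tendsto (fun i => ((n₁ i * n₂ i + m₁ i * m₂ i : ℕ) : ℝ) * r ^ d i) atTop (𝓝 0)) :
    IsThresholdLowerBound (xErasureFamily (fun i => HGP.code (H₁ i) (H₂ i))) (1 / ((q₁ + c₂ - 1 : ℕ) : ℝ)) := by
  refine x_erasure_isThresholdLowerBound_of_rowWeight _ hw
    (fun i x => hgp_card_rowSupp_HZ_le _ _ (h₁ i) (h₂ i) x) d hd1
    (fun i x hx hxS => hgp_le_weight_xLogical _ _ (hd₁ i) (hd₂ i) x hx hxS) fun r hr0 hr1 => ?_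
  exact (hgrowth r hr0 hr1).congr fun i => by rw [HGP.card_qubits]

/-- **`Z`-sector phenomenological threshold of an HGP family `≥ p₀(c₁ + q₂ + 1)`** (`q = p`): as in
`hgp_z_isThresholdLowerBound` but with space-time growth `(n₁n₂ + m₁m₂ + m₁n₂)·T i·r^{d i} → 0` and ANY
minimum-weight space-time decoders of the `T i`-round experiments. UNCONDITIONAL.
[cite: DumerKovalevPryadko2015, Thm 3 with p. 5 (w → w + 2)] -/
theorem hgp_z_phenom_isThresholdLowerBound (H₁ : ∀ i, Matrix (Fin (m₁ i)) (Fin (n₁ i)) (ZMod 2))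
    (H₂ : ∀ i, Matrix (Fin (m₂ i)) (Fin (n₂ i)) (ZMod 2)) (T : ℕ → ℕ)
    (D : ∀ i, CSSPhenom.STDecoder (Fin (m₁ i) × Fin (n₂ i))
      ((Fin (n₁ i) × Fin (n₂ i)) ⊕ (Fin (m₁ i) × Fin (m₂ i))) (T i))
    (hD : ∀ i, (D i).IsMinWeight (CSSPhenom.stSyn (HGP.code (H₁ i) (H₂ i)).HX (T i))
      (CSSPhenom.stCycles (HGP.code (H₁ i) (H₂ i)).HX (T i)) hammingNorm)
    {c₁ q₂ : ℕ} (h₁ : ∀ i a, hammingNorm (H₁ i a) ≤ c₁)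
    (h₂ : ∀ i j, hammingNorm (fun b => H₂ i b j) ≤ q₂) (d : ℕ → ℕ) (hd1 : ∀ i, 1 ≤ d i)
    (hd₁ : ∀ i, (d i : ℕ∞) ≤ minDist (pcCode (H₁ i))) (hd₂ : ∀ i, (d i : ℕ∞) ≤ minDist (pcCode (H₂ i)ᵀ))
    (hgrowth : ∀ r : ℝ, 0 < r → r < 1 →
      Tendsto (fun i => (((n₁ i * n₂ i + m₁ i * m₂ i + m₁ i * n₂ i) * T i : ℕ) : ℝ) * r ^ d i)
        atTop (𝓝 0)) :
    IsThresholdLowerBound (zPhenomFailureFamily (fun i => HGP.code (H₁ i) (H₂ i)) T D)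
      (thresholdValue ((c₁ + q₂ + 1 : ℕ) : ℝ)) := by
  refine z_phenom_isThresholdLowerBound_of_rowWeight _ T D hD
    (fun i x => hgp_card_rowSupp_HX_le _ _ (h₁ i) (h₂ i) x) d hd1
    (fun i x hx hxS => hgp_le_weight_zLogical _ _ (hd₁ i) (hd₂ i) x hx hxS) fun r hr0 hr1 => ?_
  refine (hgrowth r hr0 hr1).congr fun i => ?_
  rw [HGP.card_qubits, Fintype.card_prod, Fintype.card_fin, Fintype.card_fin]

/-- **`X`-sector phenomenological threshold of an HGP family `≥ p₀(q₁ + c₂ + 1)`** (`q = p`; space-time growth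
`(n₁n₂ + m₁m₂ + n₁m₂)·T i·r^{d i} → 0`). UNCONDITIONAL. [cite: DumerKovalevPryadko2015, Thm 3 with p. 5 (w → w + 2)] -/
theorem hgp_x_phenom_isThresholdLowerBound (H₁ : ∀ i, Matrix (Fin (m₁ i)) (Fin (n₁ i)) (ZMod 2))
    (H₂ : ∀ i, Matrix (Fin (m₂ i)) (Fin (n₂ i)) (ZMod 2)) (T : ℕ → ℕ)
    (D : ∀ i, CSSPhenom.STDecoder (Fin (n₁ i) × Fin (m₂ i))
      ((Fin (n₁ i) × Fin (n₂ i)) ⊕ (Fin (m₁ i) × Fin (m₂ i))) (T i))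
    (hD : ∀ i, (D i).IsMinWeight (CSSPhenom.stSyn (HGP.code (H₁ i) (H₂ i)).HZ (T i))
      (CSSPhenom.stCycles (HGP.code (H₁ i) (H₂ i)).HZ (T i)) hammingNorm)
    {q₁ c₂ : ℕ} (h₁ : ∀ i j, hammingNorm (fun a => H₁ i a j) ≤ q₁)
    (h₂ : ∀ i b, hammingNorm (H₂ i b) ≤ c₂) (d : ℕ → ℕ) (hd1 : ∀ i, 1 ≤ d i)
    (hd₁ : ∀ i, (d i : ℕ∞) ≤ minDist (pcCode (H₁ i)ᵀ)) (hd₂ : ∀ i, (d i : ℕ∞) ≤ minDist (pcCode (H₂ i)))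
    (hgrowth : ∀ r : ℝ, 0 < r → r < 1 →
      Tendsto (fun i => (((n₁ i * n₂ i + m₁ i * m₂ i + n₁ i * m₂ i) * T i : ℕ) : ℝ) * r ^ d i)
        atTop (𝓝 0)) :
    IsThresholdLowerBound (xPhenomFailureFamily (fun i => HGP.code (H₁ i) (H₂ i)) T D)
      (thresholdValue ((q₁ + c₂ + 1 : ℕ) : ℝ)) := by
  refine x_phenom_isThresholdLowerBound_of_rowWeight _ T D hD
    (fun i x => hgp_card_rowSupp_HZ_le _ _ (h₁ i) (h₂ i) x) d hd1
    (fun i x hx hxS => hgp_le_weight_xLogical _ _ (hd₁ i) (hd₂ i) x hx hxS) fun r hr0 hr1 => ?_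
  refine (hgrowth r hr0 hr1).congr fun i => ?_
  rw [HGP.card_qubits, Fintype.card_prod, Fintype.card_fin, Fintype.card_fin]

end Family

end Summit.Ventures.QEC.Thresholds
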